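/-
Copyright: b2b-lace packet (LEAN TYPING SEAT 1, lean1 gen 42).  The `∑'` cell corollaries of node EXL-XSLOT for the
row `(0,1)` of the `A^ι` / `Ā^ι` tables of [FvdH17] App. B: `(A^ι)_{0,1}` (leaf XSLOT-FF for its `𝓣`-member + the
carver's leaf XSLOT-S for its `𝓢`-member) and `(Ā^ι)_{0,1}` at the reference line `(A^ι)_{0,1}/(2d·p)` (leaf SYM-GAP:
the enumeration shard's gap-slice identity, consumed here).  Proofs only; no named fact; no numeral; no dimension.
-/
import Literature.Probability.FitznerVanDerHofstad2017.NobleExactLegSlotsFirst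
import Literature.Probability.FitznerVanDerHofstad2017.NobleExactLegSlotsSquare
import Literature.Probability.FitznerVanDerHofstad2017.NobleGapSliceSymm
import HarnessLib

/-!
# [FvdH17] App. B row `(0,1)`: the cells `(A^ι)_{0,1}` and `(Ā^ι)_{0,1}` at the exact-leg (5.40) slots

For the instance `Letters.perc d p` the landed closed form `matAiota_zero_one` reads
`(A^ι)_{0,1} = Σ_x Σ_y Σ_κ (1−δ_{y,0}) [δ_{x,e_κ} 𝓣_{1̲,1̲,2}(e_κ,y,0) + 𝓢_{1̲,1,1̲,1}(e_κ,x,y,0)]`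
([FvdH17] App. B Table "definition of `A^{ι,a,b}(0,v,x,y)`" row `(0,1)`, arXiv v2 p. 75).  Both members are sums
over the `2d` out-points `e_κ` of repulsive letters whose FIRST line is an exact bond, so the trail-level
extraction of node EXL-XSLOT prices them WITHOUT a `2d·p` prefactor:

* `perc_tsum_tsum_sum_kdc_kd_T_eqOne_eqOne_ge_stepVec_le_xslot` — the `𝓣`-member: the Kronecker delta collapses
  the `x`-sum, `(1−δ) ≤ 1`, and `tsum_sum_perc_T_eqOne_eqOne_ge_stepVec_le_ofReal` (leaf XSLOT-FF, multiplicity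
  one) gives `Σ_{L∈[2+m₃,M)} N₀(L) p^L + p^M Γ̄₂ R₁ + p^M Γ̄₂² R₂`;
* `perc_matAiota_zero_one_le_xslot` — **the cell**: `𝓣`-member at `m₃ = 2` plus the carver's `𝓢`-member
  `perc_tsum_tsum_sum_kdc_S_one_one_le_xslot` (leaf XSLOT-S: `bubbleSlotR p Γ̄₂ 2 2 M N₀ R₁ R₂`), the PLAIN SUM of
  the two `ofReal` prices, both at the endpoint `0` with the same remainder lists `[M]`, `[M−2, 2]`;
* `perc_matAbarIota_zero_one_le_symgap` — **the companion cell `(Ā^ι)_{0,1}`** at the reference line: in row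
  `0` the in-vertex is pinned at `0`, the out-gap slice of the class-`1̲` column vanishes off the `2d` unit gaps and
  is `W_d`-invariant, so its supremum is its average, `(Ā^ι)_{0,1} = p⁻¹ (A^ι)_{0,1} / (2d)`
  (`perc_matAbarIota_zero_one_eq` / `perc_matAbarIota_zero_one_le_of_matAiota_le` of `NobleGapSliceSymm`); the
  price is `((2d)·p)⁻¹ ×` the cell `perc_matAiota_zero_one_le_xslot`;
* `matAbarIota_zero_one_le_pinv_mul_matAiota` (ANY letter table, no symmetry used; and its non-repulsive twin) — the
  out-gap supremum is at most the out-gap sum, `(Ā^ι)_{0,1} ≤ p⁻¹ (A^ι)_{0,1}` (informational; `2d` times weaker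
  than the symmetric identity at the percolation letters).

## References
* [FvdH17] R. Fitzner, R. van der Hofstad, Mean-field behavior for nearest-neighbor percolation in `d > 10`,
  Electron. J. Probab. 22 (2017) no. 43; arXiv:1506.07977v2 — App. B Tables "A^{ι,a,b}" row (0,1) (p. 75) and
  "Ā^{ι,a,b}" (p. 78); §4.2 (4.16)–(4.18) (pp. 34–36); §5.1 (5.1) (p. 49); (6.5) (p. 58); App. D (p. 78).
* [NoBLE17] R. Fitzner, R. van der Hofstad, Generalized approach to the non-backtracking lace expansion,
  Probab. Theory Relat. Fields 169 (2017) 1041–1119 — §5.3.2 (5.40) p. 1098.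
-/

noncomputable section

namespace Literature.Probability.FitznerVanDerHofstad2017.NobleBlocks

open _root_.MeasureTheory Finset
open scoped BigOperators ENNReal
open Literature.Probability.LatticeModels Literature.Probability.Percolation
open Literature.Barriers.CriticalPhenomena
open Literature.Probability.FitznerVanDerHofstad2017
open Literature.Probability.FitznerVanDerHofstad2017.NobleBlocks.LenIdx

variable {d : ℕ}

/-! ## A. `(Ā^ι)_{0,1} ≤ p⁻¹ (A^ι)_{0,1}` for any letters -/

section AnyLetters

variable (L : Letters d)

/-- **`(Ā^ι)_{0,1} ≤ p⁻¹ · (A^ι)_{0,1}`** for ANY letters: in the closed form `matAbarIota_zero_one` the supremum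
over the out-gap `y` of the slice `Σ_x Σ_κ p⁻¹ (…)(x, x+y)` is at most the sum over `y' = x + y` of the same
summand, which is `p⁻¹ · matAiota_zero_one`.
[cite: FitznerVanDerHofstad2017, App. B Tables "A^{ι,a,b}" row (0,1) and "Ā^{ι,a,b}" (arXiv:1506.07977v2 pp. 75, 78); §5.1 "Elements of the bounds" (p. 49); (6.5) (p. 58)] -/
theorem matAbarIota_zero_one_le_pinv_mul_matAiota : matAbarIota L 0 1 ≤ L.p⁻¹ * matAiota L 0 1 := by
  rw [matAbarIota_zero_one, matAiota_zero_one, ← ENNReal.tsum_mul_left]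
  refine iSup_le fun y => ENNReal.tsum_le_tsum fun x => ?_
  rw [← Finset.mul_sum]
  gcongr
  exact ENNReal.le_tsum (x + y)

/-- The non-repulsive twin: **`(Ā^{ι,*})_{0,1} ≤ p⁻¹ · (A^{ι,*})_{0,1}`** for any letters (same argument on
`matAbarIotaSt_zero_one` / `matAiotaSt_zero_one`).
[cite: FitznerVanDerHofstad2017, §5.1 Table "Ā^{ι,a,b,*}" (arXiv:1506.07977v2 p. 47); App. B (pp. 75, 78); (6.5) (p. 58)] -/
theorem matAbarIotaSt_zero_one_le_pinv_mul_matAiotaSt : matAbarIotaSt L 0 1 ≤ L.p⁻¹ * matAiotaSt L 0 1 := by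
  rw [matAbarIotaSt_zero_one, matAiotaSt_zero_one, ← ENNReal.tsum_mul_left]
  refine iSup_le fun y => ENNReal.tsum_le_tsum fun x => ?_
  rw [← Finset.mul_sum]
  gcongr
  exact ENNReal.le_tsum (x + y)

end AnyLetters

/-! ## B. The cell `(A^ι)_{0,1}` for `Letters.perc d p` (leaves XSLOT-FF + XSLOT-S) -/

section CellZeroOne

variable (p : unitInterval)

/-- **The `𝓣`-part of `(A^ι)_{0,1}` by EXL-XSLOT (leaf XSLOT-FF)**: in the closed form `matAiota_zero_one` the
triangle term is `Σ_x Σ_y Σ_κ (1−δ_{y,0}) δ_{x,e_κ} 𝓣_{1̲,1̲,m₃}(e_κ,y,0)`; the Kronecker delta collapses the `x`-sum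
(`Σ_x δ_{x,e_κ} = 1`), `(1−δ) ≤ 1`, and the `2d` out-points `e_κ` are the first letters of the coded trails, so
`tsum_sum_perc_T_eqOne_eqOne_ge_stepVec_le_ofReal` prices the whole sum ONCE (no `2d` prefactor) by
`Σ_{L∈[2+m₃,M)} N₀(L) p^L + p^M Γ̄₂ R₁ + p^M Γ̄₂² R₂` (`R₁` valid for `[M]`, `R₂` for `[M−m₃, m₃]` on a set containing
`0`; the cell has `m₃ = 2`).
[cite: FitznerVanDerHofstad2017, App. B Table B.4 "definition of A^{ι,a,b}(0,v,x,y)" row (0,1) (arXiv:1506.07977v2 p. 75); §4.2 (4.16)–(4.18) (pp. 34–36); §5.1 (5.1) (p. 49)]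
[cite: FitznerVanDerHofstad2016NoBLE, §5.3.2 (5.40) (PTRF 169 (2017) p. 1098)] -/
theorem perc_tsum_tsum_sum_kdc_kd_T_eqOne_eqOne_ge_stepVec_le_xslot (hd : 2 ≤ d) (hp : p < criticalProbI d)
    {m₃ M : ℕ} (hM : 2 + m₃ ≤ M) {X : Set (Site d)} (h0 : (0 : Site d) ∈ X) {N₀ : ℕ → ℕ}
    (hN : ∀ L, (trailWordsTo d L (0 : Site d)).card ≤ N₀ L) {R₁ R₂ : ℝ} (hR₁ : IsRemKernelConst d [M] X R₁)
    (hR₂ : IsRemKernelConst d [M - m₃, m₃] X R₂) :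
    ∑' x, ∑' y, ∑ κ : Fin d × Bool, kdc y 0 * (kd x (stepVec κ) *
        (Letters.perc d p).T (.eq 1) (.eq 1) (.ge m₃) (stepVec κ) y 0) ≤
      ENNReal.ofReal ((∑ L ∈ Finset.Ico (2 + m₃) M, (N₀ L : ℝ) * (p : ℝ) ^ L) +
        (p : ℝ) ^ M * (nobleSup2 d p * R₁) + (p : ℝ) ^ M * (nobleSup2 d p ^ 2 * R₂)) := by
  classical
  set Lp := Letters.perc d p with hLp
  have hcollapse : ∀ (y : Site d) (κ : Fin d × Bool),
      ∑' x, kd x (stepVec κ) * Lp.T (.eq 1) (.eq 1) (.ge m₃) (stepVec κ) y 0 =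
        Lp.T (.eq 1) (.eq 1) (.ge m₃) (stepVec κ) y 0 := fun y κ => by
    rw [tsum_eq_single (stepVec κ : Site d) fun x hx => by rw [kd_of_ne hx, zero_mul], kd_self, one_mul]
  calc ∑' x, ∑' y, ∑ κ : Fin d × Bool, kdc y 0 * (kd x (stepVec κ) * Lp.T (.eq 1) (.eq 1) (.ge m₃) (stepVec κ) y 0)
      ≤ ∑' x, ∑' y, ∑ κ : Fin d × Bool, kd x (stepVec κ) * Lp.T (.eq 1) (.eq 1) (.ge m₃) (stepVec κ) y 0 :=
        ENNReal.tsum_le_tsum fun x => ENNReal.tsum_le_tsum fun y => Finset.sum_le_sum fun κ _ => by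
          calc kdc y 0 * (kd x (stepVec κ) * Lp.T (.eq 1) (.eq 1) (.ge m₃) (stepVec κ) y 0)
              ≤ 1 * (kd x (stepVec κ) * Lp.T (.eq 1) (.eq 1) (.ge m₃) (stepVec κ) y 0) := by
                gcongr; exact kdc_le_one y 0
            _ = _ := one_mul _
    _ = ∑' y, ∑ κ : Fin d × Bool, ∑' x, kd x (stepVec κ) * Lp.T (.eq 1) (.eq 1) (.ge m₃) (stepVec κ) y 0 := by
        rw [ENNReal.tsum_comm]
        exact tsum_congr fun y => Summable.tsum_finsetSum fun _ _ => ENNReal.summable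
    _ = ∑' y, ∑ κ : Fin d × Bool, Lp.T (.eq 1) (.eq 1) (.ge m₃) (stepVec κ) y 0 := by simp_rw [hcollapse]
    _ ≤ _ := tsum_sum_perc_T_eqOne_eqOne_ge_stepVec_le_ofReal p hd hp hM h0 hN hR₁ hR₂

/-- **`(A^ι)_{0,1}` by EXL-XSLOT (cell 07 of the packet's N76-EXL map)**: from `matAiota_zero_one`, the `𝓣`-member
(leaf XSLOT-FF at `m₃ = 2`: main sum over `L ∈ [4, M)`) plus the `𝓢`-member (the carver's leaf XSLOT-S,
`perc_tsum_tsum_sum_kdc_S_one_one_le_xslot`: `bubbleSlotR p Γ̄₂ 2 2 M N₀ R₁ R₂`) — the PLAIN SUM of the two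
`ofReal` prices, at the endpoint `0` (`0 ∈ X`), with `N₀` majorising the closed trail-word counts, `R₁` valid for
`[M]` and `R₂` for `[M−2, 2]` on `X`, `4 ≤ M`.  No `2d·p` prefactor; valid for every `d ≥ 2`, `p < p_c(d)`.
[cite: FitznerVanDerHofstad2017, App. B Table "definition of A^{ι,a,b}(0,v,x,y)" row (0,1) (arXiv:1506.07977v2 p. 75); §4.2 (4.16)–(4.18) (pp. 34–36); §5.1 (5.1) (p. 49)]
[cite: FitznerVanDerHofstad2016NoBLE, §5.3.2 (5.40) (PTRF 169 (2017) p. 1098)] -/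
theorem perc_matAiota_zero_one_le_xslot (hd : 2 ≤ d) (hp : p < criticalProbI d) {M : ℕ} (hM : 4 ≤ M)
    {X : Set (Site d)} (h0 : (0 : Site d) ∈ X) {N₀ : ℕ → ℕ}
    (hN : ∀ L, (trailWordsTo d L (0 : Site d)).card ≤ N₀ L) {R₁ R₂ : ℝ} (hR₁ : IsRemKernelConst d [M] X R₁)
    (hR₂ : IsRemKernelConst d [M - 2, 2] X R₂) :
    matAiota (Letters.perc d p) 0 1 ≤
      ENNReal.ofReal ((∑ L ∈ Finset.Ico 4 M, (N₀ L : ℝ) * (p : ℝ) ^ L) +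
          (p : ℝ) ^ M * (nobleSup2 d p * R₁) + (p : ℝ) ^ M * (nobleSup2 d p ^ 2 * R₂)) +
        ENNReal.ofReal (bubbleSlotR p (nobleSup2 d p) 2 2 M N₀ R₁ R₂) := by
  rw [matAiota_zero_one]
  simp_rw [mul_add, Finset.sum_add_distrib, ENNReal.tsum_add]
  exact add_le_add
    (perc_tsum_tsum_sum_kdc_kd_T_eqOne_eqOne_ge_stepVec_le_xslot p hd hp (m₃ := 2) (show 2 + 2 ≤ M by omega)
      h0 hN hR₁ hR₂)
    (perc_tsum_tsum_sum_kdc_S_one_one_le_xslot p hd hp (show 3 ≤ M by omega) h0 hN hR₁ hR₂)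

/-! ## C. The companion cell `(Ā^{ι})_{0,1}` at the reference line `(A^ι)_{0,1}/(2d·p)` (leaf SYM-GAP) -/

/-- **Cell 18, `(Ā^{ι})_{0,1}` at the percolation letters, device SYM-GAP.** By the row-`0` gap symmetry
`(Ā^{ι})_{0,1} = p⁻¹ (A^{ι})_{0,1} / (2d)` (`perc_matAbarIota_zero_one_eq` of `NobleGapSliceSymm`: the in-vertex
is pinned at `0`, the `y`-slice of the class-`1̲` column vanishes off the `2d` unit gaps and is `W_d`-invariant,
so `sup_y = (2d)⁻¹ Σ_y`), cell 18 is priced at `((2d)·p)⁻¹ ×` the cell-07 price `perc_matAiota_zero_one_le_xslot`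
— the reference line `Bound[AiotaBar,0,1] = Bound[Aiota,0,1]/(2d z)` of the `d = 11` notebooks, here a kernel
inequality for every `d ≥ 2`, `p < p_c`.
[cite: FitznerVanDerHofstad2017, App. B Table B.4 row (0,1) (arXiv:1506.07977v2 p. 74); §5.1 (5.1) p. 49; §5.4.2 (5.40)–(5.41) p. 56; App. D p. 78] -/
theorem perc_matAbarIota_zero_one_le_symgap (hd : 2 ≤ d) (hp : p < criticalProbI d) {M : ℕ} (hM : 4 ≤ M)
    {X : Set (Site d)} (h0 : (0 : Site d) ∈ X) {N₀ : ℕ → ℕ}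
    (hN : ∀ L, (trailWordsTo d L (0 : Site d)).card ≤ N₀ L) {R₁ R₂ : ℝ} (hR₁ : IsRemKernelConst d [M] X R₁)
    (hR₂ : IsRemKernelConst d [M - 2, 2] X R₂) :
    matAbarIota (Letters.perc d p) 0 1 ≤ ((2 * d : ℝ≥0∞) * ENNReal.ofReal (p : ℝ))⁻¹ *
      (ENNReal.ofReal ((∑ L ∈ Finset.Ico 4 M, (N₀ L : ℝ) * (p : ℝ) ^ L) +
          (p : ℝ) ^ M * (nobleSup2 d p * R₁) + (p : ℝ) ^ M * (nobleSup2 d p ^ 2 * R₂)) +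
        ENNReal.ofReal (bubbleSlotR p (nobleSup2 d p) 2 2 M N₀ R₁ R₂)) :=
  perc_matAbarIota_zero_one_le_of_matAiota_le p (by omega)
    (perc_matAiota_zero_one_le_xslot p hd hp hM h0 hN hR₁ hR₂)

end CellZeroOne

end Literature.Probability.FitznerVanDerHofstad2017.NobleBlocks
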